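import Literature.MathematicalPhysics.QuantumFieldTheory.Balaban1983to89.B9Eq382V3Letters

/-!
# `Balaban1983to89.B9Eq373CommLetters` — B9 p. 407 «The operator V₃(A) is a local differential operator of the first order satisfying
# the bound (3.73)» read against the right entry of (3.85)/(3.42)₃ (device `B9Ineq386CommSum.thm34_G_entries13_opForm_of_comm_sum`,
# hypothesis `hComm : V¹_k∇_k − ∇_kV¹_k ≺ c_Kα₁(Lʲη)⁻²e^{−δd}`): THE COMMUTATORS OF THE COEFFICIENT LETTERS OF THE CONCRETE `V₃(A)`
# WITH THE COVARIANT DIFFERENCES, PART 1 — the letters WITHOUT transport–difference curvature: the diagonal coefficient letters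
# (lattice Leibniz rule, gen 8 on the bond carrier), the backward mixing letter `mixLetterB` of (3.71) and the forward mixing letter
# `mixLetterF₂` of (3.75), as EXACT commutator identities with zeroth-order block majorants `O(1)α₁(Lʲη)⁻²e^{−δd}`; sixth file of the
# G-side twin

statement-level skeleton of published theorems with citation tags; proofs where landed; nothing here is a claim about the Yang–Mills mass gap

CITATION HEADER (lean-in-tree rule).  T. Bałaban, *Propagators for lattice gauge theories in a background field*, Commun. Math. Phys.
**99** (1985) 389–434 [Balaban1985BackgroundPropagators] (cell paper B9; held `paper:balaban1985-cmp99-background-propagators`, journal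
page = PDF page + 388), p. 405 [PDF 17] (3.73) and p. 407 [PDF 19] (3.82)/(3.85) (materialised pages p0017/p0019 read by this seat,
2026-08-21).  THE PRINT (verbatim): p. 405 «The operator V₁ satisfies |(V₁(A)A′)(b)| ≦ O(1)(|A||∇A′| + |∇A||A′| + |A|²|A′|) ≦ O(1)α₁((Lʲη)⁻¹
|∇A′| + (Lʲη)⁻²|A′|), b ∈ Ω_j, (3.73) […] The derivatives are, of course, the covariant derivatives defined by U.»; p. 407 «The operator
V₃(A) is a local differential operator of the first order satisfying the bound (3.73).» and (3.85) «|(V(A)G(U)J)(b)| ≦ O(1)α₁e^{−(1/2)δ₀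
d(y,y′)}|J|».  The lattice Leibniz rule: T. Bałaban, *Averaging operations for lattice gauge theories*, CMP **98** (1985) 17–51 = [B8]
[Balaban1985RegularSpaces], (1.86)–(1.87) p. 91 (as cited by gen 8's `B9Eq352DivFormLetters.mul_grad_comm_F`).  [4] = [Balaban1984PropagatorsII]
(2.51)–(2.52) p. 232.  Cell `lit-balaban`, seat r06 (B9 fold owner) gen 10; SKELETON rows **B9.Eq3.85** × **B9.Eq3.71** × **B9.Eq3.74** ×
B9.Thm3.4.  WHY THIS FILE: the right entry (3.42)₃ of Theorem 3.4's G-clause goes through the divergence form `V₃ = V⁰ + Σ_k∇_kV¹_k − Σ_k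
[∇_k, V¹_k]` (gen 7–8 devices); the concrete `V¹_k` of the G-side twin are `conj b (V1Letter A k) + conj b (V1Letter₂ A k)` (files 1, 2, 4),
so `hComm` needs the commutators of `coefLetter` (diagonal), `mixLetterF`, `mixLetterB` ((3.71)) and `mixLetterF₂`, `mixLetterB₂` ((3.75))
with `∇_k = diffLetter (bT T) (bU U) η⁻¹ k`.  This file does the three that close WITHOUT the plaquette curvature of `U`; `mixLetterF`
and `mixLetterB₂` (whose transports `τ*_ν`, `τ_μ` do not commute with `∇_k` — the commutator is the plaquette holonomy, bounded by
(3.35)) are the successor file.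

SIBLINGS REUSED BY NAME (imported; nothing restated): gen 8's `B9Eq352GradLetters.hasMajorant_comm_coefLetter_diffLetter` (both
orientations of the diagonal commutator, lattice Leibniz rule `B9Eq352DivFormLetters.mul_grad_comm_F/B`) — instantiated on the bond
carrier; files 1–2's `mixLetterB`, `mixLetterF₂`, `V1Letter_inr`, `V1Letter₂_inl`, `bT`/`bU`/`Ab`, `covD_bond`/`covDstar_bond`; gen 8's
`conj`, `conj_mul/sub/neg/add`, `diffLetter_inl/inr`, `gradLetterF/B_apply`, seam lemma `hasMajorant_conj_of_local`; pv27's `R_ad`,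
`B9Eq369Small.norm_R_le_rho`/`norm_R_inv_le_rho`.

WHAT THIS FILE PROVES (0 sorry; defs with bodies + theorems; no `def … : Prop`).
* §1 THE COMMUTATOR LETTERS: `commMixB c A k₀ : F ↦ ((μ,x) ↦ i[c·(D¹*_{k₀}A_μ)(x), (τ*_{k₀}F_{k₀})(x)])` and `commMixF₂ c A k₀ : F ↦ ((μ,x)
  ↦ 𝟙[μ = k₀]·Σ_ν i[c·(D¹_{k₀}A_ν)(x), (τ_{k₀}F_ν)(x)])` (ℝ-linear, `_apply` rfl) and the EXACT IDENTITIES **`comm_mixLetterB`**: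
  `mixLetterB A k₀ * ∇_{inr k₀} − ∇_{inr k₀} * mixLetterB A k₀ = −commMixB η⁻¹ A k₀` and **`comm_mixLetterF₂`**: `mixLetterF₂ A k₀ *
  ∇_{inl k₀} − ∇_{inl k₀} * mixLetterF₂ A k₀ = −commMixF₂ η⁻¹ A k₀` (`∇_{inl k₀} = gradLetterF`, `∇_{inr k₀} = −gradLetterB` on the bond
  carrier) — the lattice Leibniz rule for the component-mixing letters: the commutator of a multiplication-by-`A` letter with a
  covariant difference is multiplication by the covariant difference OF `A`, composed with a transport (zeroth order, size `|∇A| ≦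
  α₁(Lʲη)⁻²`).
* §2 BLOCK MAJORANTS after real coordinates (block map `((μ,x),i) ↦ y(x)`), under (3.37) read blockwise for the covariant
  differences of `A` as they occur (`‖η⁻¹D¹*_kA_μ(x)‖, ‖η⁻¹D¹_kA_ν(x)‖ ≦ α₁(Lʲη)⁻²`, ALL index pairs), transports `≦ ρ`, neighbouring
  blocks at `d`-distance `≦ d₀`: `hasMajorant_commMixB` (≺ 2ρ²M₂(Σ‖b_i‖)e^{δd₀}·α₁(Lʲη)⁻²e^{−δd}), `hasMajorant_commMixF₂` (≺ 2ρ²d·…);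
  **`hasMajorant_comm_coefLetter_bond`** (gen 8's diagonal commutator bound on the bond carrier, both orientations: ≺ 2ρ²M₂(Σ‖b_i‖)
  e^{δd₀}·α₁(Lʲη)⁻²e^{−δd}); and the two `hComm` members that are complete with this file: **`hasMajorant_comm_V1Letter_inr`**
  (`[conj b (V1Letter A (inr k₀)), ∇_{inr k₀}] ≺ 4ρ²M₂(Σ‖b_i‖)e^{δd₀}·α₁(Lʲη)⁻²e^{−δd}`) and **`hasMajorant_comm_V1Letter₂_inl`**
  (`[conj b (V1Letter₂ A (inl k₀)), ∇_{inl k₀}] ≺ 2ρ²d·M₂(Σ‖b_i‖)e^{δd₀}·α₁(Lʲη)⁻²e^{−δd}`).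

HONEST SCOPE / NOT CLAIMED.  (i) The two remaining members `[conj b (V1Letter A (inl k₀)), ∇_{inl k₀}]` (through `mixLetterF`) and
`[conj b (V1Letter₂ A (inr k₀)), ∇_{inr k₀}]` (through `mixLetterB₂`) involve `[∇_{k₀}, τ*_ν]`/`[∇*_{k₀}, τ_μ]` = the plaquette
holonomy `U(∂p) − 1` of the background (commuting shifts needed to close the plaquette); they are NOT here — so `hComm` of the device is
NOT yet complete for the concrete `V₃`, and entry (3.42)₃ for it is not claimed.  (ii) Hypotheses are (3.37) read blockwise on the
covariant differences of the exponent field with the OUTPUT block's scale, transports, stencil block distances — as in files 1–4.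
(iii) Operator (block-majorant) form, abstract carrier.  Value = two of the four mixing commutators and the diagonal ones, exactly;
NOT summit progress.

RELATED IN THE TREE, NOT DUPLICATED (searched 2026-08-21: `lean search --decl 'commMixB|commMixF|comm_mixLetter|hasMajorant_comm_V1Letter'`
= ∅): gen 8's `B9Eq352DivFormLetters.commLetterF/B` + `mul_grad_comm_F/B` are the scalar-carrier (diagonal) commutators — reused through
`hasMajorant_comm_coefLetter_diffLetter`, not restated; nothing in the tree treats the component-mixing letters.
-/

noncomputable section

namespace Literature.MathematicalPhysics.QuantumFieldTheory.Balaban1983to89.B9Eq373CommLetters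

open NormedSpace Complex
open Literature.MathematicalPhysics.QuantumFieldTheory.Balaban1983to89
open Literature.MathematicalPhysics.QuantumFieldTheory.Balaban1983to89.B6RandomWalk (HasMajorant hasMajorant_mono hasMajorant_add)
open Literature.MathematicalPhysics.QuantumFieldTheory.Balaban1983to89.B9Thm34Ext (toB6)
open Literature.MathematicalPhysics.QuantumFieldTheory.Balaban1983to89.Beta.BackgroundVertices (ad norm_ad_le ad_smul_left
  ad_smul_right ad_sub_left ad_sub_right ad_add_right)
open Literature.MathematicalPhysics.QuantumFieldTheory.Balaban1983to89.B9Eq39Adjoint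
open Literature.MathematicalPhysics.QuantumFieldTheory.Balaban1983to89.B9Eq369Small (norm_R_le_rho norm_R_inv_le_rho)
open Literature.MathematicalPhysics.QuantumFieldTheory.Balaban1983to89.B9Eq371Composition (R_ad)
open Literature.MathematicalPhysics.QuantumFieldTheory.Balaban1983to89.B9Eq352DivForm (tauF tauB tauF_apply tauB_apply)
open Literature.MathematicalPhysics.QuantumFieldTheory.Balaban1983to89.B9Eq352DivFormLetters
open Literature.MathematicalPhysics.QuantumFieldTheory.Balaban1983to89.B9Eq352GradLetters (coefLetter diffLetter diffLetter_inl
  diffLetter_inr conj_add hasMajorant_comm_coefLetter_diffLetter)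
open Literature.MathematicalPhysics.QuantumFieldTheory.Balaban1983to89.B9Eq371GradLetters (bT bU Ab bT_apply bT_symm_apply bU_apply
  Ab_apply covD_bond covDstar_bond tauB_bond mixLetterB mixLetterB_apply V1Letter V1Letter_inr)
open Literature.MathematicalPhysics.QuantumFieldTheory.Balaban1983to89.B9Eq375GradLetters (mixLetterF₂ mixLetterF₂_apply V1Letter₂
  V1Letter₂_inl)

/-! ## §1  The commutator letters and the exact identities -/

section Letters

variable {𝔸 : Type*} [NormedRing 𝔸] [NormedAlgebra ℂ 𝔸] {S : Type} {κ : Type}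
variable (T : κ → Equiv.Perm S) (U : κ → S → 𝔸ˣ)

omit [NormedAlgebra ℂ 𝔸] T U in
/-- `R(V)(r·X) = r·R(V)X` for REAL scalars. [folklore] -/
private theorem R_real_smul [NormedAlgebra ℂ 𝔸] (V : 𝔸ˣ) (r : ℝ) (X : 𝔸) : R V (r • X) = r • R V X := by
  rw [R_def, R_def, mul_smul_comm, smul_mul_assoc]

omit [NormedAlgebra ℂ 𝔸] T U in
/-- `R(V)` of a finite sum. [folklore] -/
private theorem R_finset_sum {α : Type*} (V : 𝔸ˣ) (s : Finset α) (f : α → 𝔸) :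
    R V (∑ i ∈ s, f i) = ∑ i ∈ s, R V (f i) := by
  simp only [R_def, Finset.mul_sum, Finset.sum_mul]

/-- **THE COMMUTATOR LETTER OF `mixLetterB`**: `F ↦ ((μ,x) ↦ i[c·(D¹*_{k₀}A_μ)(x), (τ*_{k₀}F_{k₀})(x)])` — multiplication by the backward
covariant difference of `A_μ` along `k₀`, composed with the backward transport of the `k₀`-component.
[cite: Balaban1985BackgroundPropagators, (3.71) p.405 + (3.73) p.405; Balaban1985RegularSpaces, (1.86)–(1.87) p.91] -/
def commMixB (c : ℂ) (A : κ → S → 𝔸) (k₀ : κ) : Module.End ℝ (κ × S → 𝔸) where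
  toFun F := fun p => (I : ℂ) • ad (c • covDstar T U k₀ (A p.1) p.2) (tauB T U k₀ (fun z => F (k₀, z)) p.2)
  map_add' F F' := by
    funext p
    simp only [Pi.add_apply, tauB_apply, R_add, ad_add_right, smul_add]
  map_smul' r F := by
    funext p
    simp only [Pi.smul_apply, RingHom.id_apply, tauB_apply, R_real_smul, ad_smul_right]
    rw [smul_comm r (I : ℂ)]

/-- Unfolding `commMixB`. [cite: Balaban1985BackgroundPropagators, (3.71) p.405] -/
theorem commMixB_apply (c : ℂ) (A : κ → S → 𝔸) (k₀ : κ) (F : κ × S → 𝔸) (p : κ × S) :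
    commMixB T U c A k₀ F p = (I : ℂ) • ad (c • covDstar T U k₀ (A p.1) p.2) (tauB T U k₀ (fun z => F (k₀, z)) p.2) := rfl

variable [Fintype κ] [DecidableEq κ]

/-- **THE COMMUTATOR LETTER OF `mixLetterF₂`**: `F ↦ ((μ,x) ↦ 𝟙[μ = k₀]·Σ_ν i[c·(D¹_{k₀}A_ν)(x), (τ_{k₀}F_ν)(x)])`.
[cite: Balaban1985BackgroundPropagators, (3.75) p.405 + (3.73) p.405; Balaban1985RegularSpaces, (1.86)–(1.87) p.91] -/
def commMixF₂ (c : ℂ) (A : κ → S → 𝔸) (k₀ : κ) : Module.End ℝ (κ × S → 𝔸) where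
  toFun F := fun p => (if p.1 = k₀ then (1 : ℝ) else 0) •
    ∑ ν, (I : ℂ) • ad (c • covD T U k₀ (A ν) p.2) (tauF T U k₀ (fun z => F (ν, z)) p.2)
  map_add' F F' := by
    funext p
    dsimp only [Pi.add_apply]
    rw [← smul_add (if p.1 = k₀ then (1 : ℝ) else 0), ← Finset.sum_add_distrib]
    congr 1
    refine Finset.sum_congr rfl fun ν _ => ?_
    simp only [tauF_apply, R_add, ad_add_right, smul_add]
  map_smul' r F := by
    funext p
    dsimp only [Pi.smul_apply, RingHom.id_apply]
    rw [smul_comm r (if p.1 = k₀ then (1 : ℝ) else 0)]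
    congr 1
    rw [Finset.smul_sum]
    refine Finset.sum_congr rfl fun ν _ => ?_
    simp only [tauF_apply, R_real_smul, ad_smul_right]
    rw [smul_comm r (I : ℂ)]

/-- Unfolding `commMixF₂`. [cite: Balaban1985BackgroundPropagators, (3.75) p.405] -/
theorem commMixF₂_apply (c : ℂ) (A : κ → S → 𝔸) (k₀ : κ) (F : κ × S → 𝔸) (p : κ × S) :
    commMixF₂ T U c A k₀ F p = (if p.1 = k₀ then (1 : ℝ) else 0) •
      ∑ ν, (I : ℂ) • ad (c • covD T U k₀ (A ν) p.2) (tauF T U k₀ (fun z => F (ν, z)) p.2) := rfl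

omit [Fintype κ] [DecidableEq κ] in
/-- **`[mixLetterB, ∇_{inr k₀}]` EXACTLY** (`∇_{inr k₀} = −η⁻¹D¹*_{k₀}` on the bond carrier): `mixLetterB A k₀ * ∇ − ∇ * mixLetterB A k₀ =
−commMixB c A k₀` — the lattice Leibniz rule for the backward mixing letter of (3.71) (term 7): `[A_μ(x), ·]` commutes with
`D¹*_{k₀}` up to multiplication by `(D¹*_{k₀}A_μ)(x)` composed with `τ*_{k₀}`.
[cite: Balaban1985BackgroundPropagators, (3.71) p.405 + (3.73) p.405; Balaban1985RegularSpaces, (1.86)–(1.87) p.91] -/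
theorem comm_mixLetterB (c : ℂ) (A : κ → S → 𝔸) (k₀ : κ) :
    mixLetterB A k₀ * diffLetter (bT T) (bU U) c (Sum.inr k₀) - diffLetter (bT T) (bU U) c (Sum.inr k₀) * mixLetterB A k₀
      = -commMixB T U c A k₀ := by
  apply LinearMap.ext
  intro F
  funext p
  obtain ⟨μ, x⟩ := p
  have hcI : c * I = I * c := mul_comm c I
  simp only [diffLetter_inr, LinearMap.sub_apply, Module.End.mul_apply, LinearMap.neg_apply, map_neg, Pi.sub_apply, Pi.neg_apply,
    mixLetterB_apply, gradLetterB_apply, covDstar_bond, commMixB_apply]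
  simp only [covDstar, tauB_apply, R_neg, R_smul, R_ad, ad_smul_left, ad_smul_right, ad_sub_left, ad_sub_right, smul_sub, smul_neg,
    smul_smul, neg_neg, hcI]
  abel

/-- **`[mixLetterF₂, ∇_{inl k₀}]` EXACTLY** (`∇_{inl k₀} = η⁻¹D¹_{k₀}`): `mixLetterF₂ A k₀ * ∇ − ∇ * mixLetterF₂ A k₀ = −commMixF₂ c A k₀` —
the lattice Leibniz rule for the forward mixing letter of (3.75) (term 4).
[cite: Balaban1985BackgroundPropagators, (3.75) p.405 + (3.73) p.405; Balaban1985RegularSpaces, (1.86)–(1.87) p.91] -/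
theorem comm_mixLetterF₂ (c : ℂ) (A : κ → S → 𝔸) (k₀ : κ) :
    mixLetterF₂ A k₀ * diffLetter (bT T) (bU U) c (Sum.inl k₀) - diffLetter (bT T) (bU U) c (Sum.inl k₀) * mixLetterF₂ A k₀
      = -commMixF₂ T U c A k₀ := by
  apply LinearMap.ext
  intro F
  funext p
  obtain ⟨μ, x⟩ := p
  have hcI : c * I = I * c := mul_comm c I
  simp only [diffLetter_inl, LinearMap.sub_apply, Module.End.mul_apply, Pi.sub_apply, Pi.neg_apply, LinearMap.neg_apply,
    mixLetterF₂_apply, gradLetterF_apply, covD_bond, commMixF₂_apply]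
  by_cases hμ : μ = k₀
  · subst hμ
    simp only [if_true, one_smul, covD, tauF_apply, R_finset_sum, R_smul, R_ad, ad_smul_left, ad_smul_right, ad_sub_left,
      ad_sub_right, smul_sub, smul_smul, hcI, Finset.smul_sum, Finset.sum_sub_distrib]
    abel
  · simp only [hμ, if_false, zero_smul, covD, R_zero, sub_zero, smul_zero, neg_zero]

end Letters

/-! ## §2  Block majorants and the two complete `hComm` members -/

section Majorants

variable {𝔸 : Type*} [NormedRing 𝔸] [NormedAlgebra ℂ 𝔸] {ι : Type} [Fintype ι]
variable (b : Module.Basis ι ℝ 𝔸) {S : Type} {κ : Type}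
variable (T : κ → Equiv.Perm S) (U : κ → S → 𝔸ˣ)
variable {g : B9.Geometry} [Fintype g.Site] {Rr : ℝ} {H : Prop}

omit [Fintype ι] b T U [Fintype g.Site] in
/-- `‖i·[a, Z]‖ ≦ 2st` when `‖a‖ ≦ s`, `‖Z‖ ≦ t`. [folklore] -/
private theorem norm_I_ad_le {a Z : 𝔸} {s t : ℝ} (ha : ‖a‖ ≤ s) (hZ : ‖Z‖ ≤ t) : ‖(I : ℂ) • ad a Z‖ ≤ 2 * s * t := by
  rw [norm_smul, Complex.norm_I, one_mul]
  have hs : 0 ≤ s := (norm_nonneg _).trans ha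
  exact (norm_ad_le _ _).trans (mul_le_mul (mul_le_mul_of_nonneg_left ha zero_le_two) hZ (norm_nonneg _) (by positivity))

omit [Fintype ι] b T U in
/-- `−L` has the majorants of `L`. [folklore] -/
private theorem hasMajorant_neg' {X : Type} (blk : X → g.Site) {L : Module.End ℝ (X → ℝ)}
    {K : g.Site → g.Site → ℝ} (h : HasMajorant (g := toB6 g Rr H) blk L K) : HasMajorant (g := toB6 g Rr H) blk (-L) K := by
  intro y' μ B hμ x
  simpa using h y' μ B hμ x

/-- **THE DIAGONAL COMMUTATORS ON THE BOND CARRIER** — gen 8's `hasMajorant_comm_coefLetter_diffLetter` instantiated: under (3.37) read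
blockwise for `‖η⁻¹D¹_μA_μ(x)‖`, `‖η⁻¹D¹*_μτ*_μA_μ(x)‖ ≦ α₁(Lʲη)⁻²`, transports `≦ ρ`, neighbouring blocks at distance `≦ d₀`:
`conj b (coefLetter k) * conj b (∇_k) − conj b (∇_k) * conj b (coefLetter k) ≺ 2ρ²M₂(Σ‖b_i‖)e^{δd₀}·α₁(Lʲη)⁻²·e^{−δd}`, every `k ∈ κ ⊕ κ`.
[cite: Balaban1985BackgroundPropagators, (3.37) p.396 + (3.71) p.405 + (3.73) p.405; Balaban1985RegularSpaces, (1.87) p.91; Balaban1984PropagatorsII, (2.51) p.232] -/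
theorem hasMajorant_comm_coefLetter_bond (blk : S → g.Site) (η : ℝ) (A : κ → S → 𝔸) (ρ d₀ δ M₂ α₁ : ℝ)
    (hα₁ : 0 ≤ α₁) (hδ : 0 ≤ δ) (hM₂ : 0 ≤ M₂) (hrepr : ∀ (v : 𝔸) (i : ι), |b.repr v i| ≤ M₂ * ‖v‖)
    (h337F : ∀ μ x, ‖((η : ℂ)⁻¹) • covD T U μ (A μ) x‖ ≤ α₁ * (g.len (blk x) ^ 2)⁻¹)
    (h337B : ∀ μ x, ‖((η : ℂ)⁻¹) • covDstar T U μ (tauB T U μ (A μ)) x‖ ≤ α₁ * (g.len (blk x) ^ 2)⁻¹)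
    (hρ : ∀ μ x, ‖((U μ x : 𝔸ˣ) : 𝔸)‖ ≤ ρ ∧ ‖(((U μ x)⁻¹ : 𝔸ˣ) : 𝔸)‖ ≤ ρ)
    (hd₀ : ∀ μ x, g.dist (blk x) (blk (T μ x)) ≤ d₀ ∧ g.dist (blk x) (blk ((T μ).symm x)) ≤ d₀) (k : κ ⊕ κ) :
    HasMajorant (g := toB6 g Rr H) (fun q : (κ × S) × ι => blk q.1.2)
      (conj b (coefLetter (bT T) (bU U) (Ab A) k) * conj b (diffLetter (bT T) (bU U) ((η : ℂ)⁻¹) k)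
        - conj b (diffLetter (bT T) (bU U) ((η : ℂ)⁻¹) k) * conj b (coefLetter (bT T) (bU U) (Ab A) k))
      (fun y y' => (2 * ρ ^ 2 * M₂ * (∑ i, ‖b i‖) * Real.exp (δ * d₀)) * α₁ * (g.len y ^ 2)⁻¹ *
        Real.exp (-(δ * g.dist y y'))) :=
  hasMajorant_comm_coefLetter_diffLetter (Rr := Rr) (H := H) b (bT T) (bU U) (fun p : κ × S => blk p.2) η (Ab A) ρ d₀ δ M₂ α₁
    hα₁ hδ hM₂ hrepr (fun μ p => h337F μ p.2) (fun μ p => h337B μ p.2) (fun μ p => hρ μ p.2) (fun μ p => hd₀ μ p.2) k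

/-- **THE `mixLetterB` COMMUTATOR LETTER IS `O(1)α₁(Lʲη)⁻²`**: under `‖c·D¹*_kA_μ(x)‖ ≦ α₁(Lʲη)⁻²` (all `k, μ`), transports `≦ ρ` and the
backward neighbour's block at distance `≦ d₀`: `conj b (commMixB c A k₀) ≺ 2ρ²M₂(Σ‖b_i‖)e^{δd₀}·α₁(Lʲη)⁻²·e^{−δd}`.
[cite: Balaban1985BackgroundPropagators, (3.37) p.396 + (3.73) p.405; Balaban1984PropagatorsII, (2.51)–(2.52) p.232] -/
theorem hasMajorant_commMixB (blk : S → g.Site) (c : ℂ) (A : κ → S → 𝔸) (ρ d₀ δ M₂ α₁ : ℝ)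
    (hα₁ : 0 ≤ α₁) (hδ : 0 ≤ δ) (hM₂ : 0 ≤ M₂) (hrepr : ∀ (v : 𝔸) (i : ι), |b.repr v i| ≤ M₂ * ‖v‖)
    (h337B : ∀ k μ x, ‖c • covDstar T U k (A μ) x‖ ≤ α₁ * (g.len (blk x) ^ 2)⁻¹)
    (hρ : ∀ μ x, ‖((U μ x : 𝔸ˣ) : 𝔸)‖ ≤ ρ ∧ ‖(((U μ x)⁻¹ : 𝔸ˣ) : 𝔸)‖ ≤ ρ)
    (hd₀B : ∀ μ x, g.dist (blk x) (blk ((T μ).symm x)) ≤ d₀) (k₀ : κ) :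
    HasMajorant (g := toB6 g Rr H) (fun q : (κ × S) × ι => blk q.1.2) (conj b (commMixB T U c A k₀))
      (fun y y' => (2 * ρ ^ 2 * M₂ * (∑ i, ‖b i‖) * Real.exp (δ * d₀)) * α₁ * (g.len y ^ 2)⁻¹ *
        Real.exp (-(δ * g.dist y y'))) := by
  have hc0 : ∀ y : g.Site, 0 ≤ 2 * ρ ^ 2 * α₁ * (g.len y ^ 2)⁻¹ := fun y => by positivity
  refine hasMajorant_mono (g := toB6 g Rr H) _
    (hasMajorant_conj_of_local (Rr := Rr) (H := H) b (fun p : κ × S => blk p.2) (fun p q => q.2 = (T k₀).symm p.2)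
      (fun y => 2 * ρ ^ 2 * α₁ * (g.len y ^ 2)⁻¹) d₀ δ M₂ hc0 hδ hM₂ hrepr (fun p q h => by rw [h]; exact hd₀B k₀ p.2)
      (commMixB T U c A k₀) ?_)
    fun y y' => le_of_eq (by ring)
  intro F p B hB
  rw [commMixB_apply, tauB_apply]
  have hτ : ‖R (U k₀ ((T k₀).symm p.2))⁻¹ (F (k₀, (T k₀).symm p.2))‖ ≤ ρ ^ 2 * B :=
    (norm_R_inv_le_rho (hρ k₀ _).1 (hρ k₀ _).2 _).trans
      (mul_le_mul_of_nonneg_left (hB (k₀, (T k₀).symm p.2) rfl) (sq_nonneg ρ))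
  calc ‖(I : ℂ) • ad (c • covDstar T U k₀ (A p.1) p.2) (R (U k₀ ((T k₀).symm p.2))⁻¹ (F (k₀, (T k₀).symm p.2)))‖
      ≤ 2 * (α₁ * (g.len (blk p.2) ^ 2)⁻¹) * (ρ ^ 2 * B) := norm_I_ad_le (h337B k₀ p.1 p.2) hτ
    _ = 2 * ρ ^ 2 * α₁ * (g.len (blk p.2) ^ 2)⁻¹ * B := by ring

/-- **THE `mixLetterF₂` COMMUTATOR LETTER IS `O(1)α₁(Lʲη)⁻²`**: under `‖c·D¹_kA_ν(x)‖ ≦ α₁(Lʲη)⁻²` (all `k, ν`), transports `≦ ρ` and the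
forward neighbour's block at distance `≦ d₀`: `conj b (commMixF₂ c A k₀) ≺ 2ρ²d·M₂(Σ‖b_i‖)e^{δd₀}·α₁(Lʲη)⁻²·e^{−δd}` (`d = |κ|`).
[cite: Balaban1985BackgroundPropagators, (3.37) p.396 + (3.73) p.405 + (3.75) p.405; Balaban1984PropagatorsII, (2.51)–(2.52) p.232] -/
theorem hasMajorant_commMixF₂ [Fintype κ] [DecidableEq κ] (blk : S → g.Site) (c : ℂ) (A : κ → S → 𝔸) (ρ d₀ δ M₂ α₁ : ℝ)
    (hα₁ : 0 ≤ α₁) (hδ : 0 ≤ δ) (hM₂ : 0 ≤ M₂) (hrepr : ∀ (v : 𝔸) (i : ι), |b.repr v i| ≤ M₂ * ‖v‖)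
    (h337F : ∀ k ν x, ‖c • covD T U k (A ν) x‖ ≤ α₁ * (g.len (blk x) ^ 2)⁻¹)
    (hρ : ∀ μ x, ‖((U μ x : 𝔸ˣ) : 𝔸)‖ ≤ ρ ∧ ‖(((U μ x)⁻¹ : 𝔸ˣ) : 𝔸)‖ ≤ ρ)
    (hd₀F : ∀ μ x, g.dist (blk x) (blk (T μ x)) ≤ d₀) (k₀ : κ) :
    HasMajorant (g := toB6 g Rr H) (fun q : (κ × S) × ι => blk q.1.2) (conj b (commMixF₂ T U c A k₀))
      (fun y y' => (2 * ρ ^ 2 * Fintype.card κ * M₂ * (∑ i, ‖b i‖) * Real.exp (δ * d₀)) * α₁ * (g.len y ^ 2)⁻¹ *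
        Real.exp (-(δ * g.dist y y'))) := by
  have hc0 : ∀ y : g.Site, 0 ≤ 2 * ρ ^ 2 * Fintype.card κ * α₁ * (g.len y ^ 2)⁻¹ := fun y => by positivity
  refine hasMajorant_mono (g := toB6 g Rr H) _
    (hasMajorant_conj_of_local (Rr := Rr) (H := H) b (fun p : κ × S => blk p.2) (fun p q => q.2 = T k₀ p.2)
      (fun y => 2 * ρ ^ 2 * Fintype.card κ * α₁ * (g.len y ^ 2)⁻¹) d₀ δ M₂ hc0 hδ hM₂ hrepr (fun p q h => by rw [h]; exact hd₀F k₀ p.2)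
      (commMixF₂ T U c A k₀) ?_)
    fun y y' => le_of_eq (by ring)
  intro F p B hB
  have hB0 : 0 ≤ ρ ^ 2 * B := by
    have h1 := hB (k₀, T k₀ p.2) rfl
    have h2 : ‖R (U k₀ p.2) (F (k₀, T k₀ p.2))‖ ≤ ρ ^ 2 * ‖F (k₀, T k₀ p.2)‖ := norm_R_le_rho (hρ k₀ p.2).1 (hρ k₀ p.2).2 _
    nlinarith [norm_nonneg (R (U k₀ p.2) (F (k₀, T k₀ p.2))), norm_nonneg (F (k₀, T k₀ p.2)), sq_nonneg ρ]
  rw [commMixF₂_apply]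
  have hsum : ‖∑ ν, (I : ℂ) • ad (c • covD T U k₀ (A ν) p.2) (tauF T U k₀ (fun z => F (ν, z)) p.2)‖
      ≤ Fintype.card κ * (2 * (α₁ * (g.len (blk p.2) ^ 2)⁻¹) * (ρ ^ 2 * B)) := by
    refine (norm_sum_le _ _).trans ?_
    rw [← Finset.card_univ, ← nsmul_eq_mul, ← Finset.sum_const]
    refine Finset.sum_le_sum fun ν _ => norm_I_ad_le (h337F k₀ ν p.2) ?_
    rw [tauF_apply]
    exact (norm_R_le_rho (hρ k₀ p.2).1 (hρ k₀ p.2).2 _).trans (mul_le_mul_of_nonneg_left (hB (ν, T k₀ p.2) rfl) (sq_nonneg ρ))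
  split_ifs with h
  · rw [one_smul]
    refine hsum.trans (le_of_eq ?_)
    ring
  · rw [zero_smul, norm_zero]
    have e : 2 * ρ ^ 2 * Fintype.card κ * α₁ * (g.len (blk p.2) ^ 2)⁻¹ * B
        = (2 * Fintype.card κ * α₁ * (g.len (blk p.2) ^ 2)⁻¹) * (ρ ^ 2 * B) := by ring
    rw [e]
    exact mul_nonneg (by positivity) hB0

variable [Fintype κ] [DecidableEq κ]

/-- **`hComm` FOR `V1Letter (inr k₀)` — COMPLETE**: `conj b (V1Letter A (inr k₀)) * conj b (∇_{inr k₀}) − conj b (∇_{inr k₀}) * conj b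
(V1Letter A (inr k₀)) ≺ 4ρ²M₂(Σ‖b_i‖)e^{δd₀}·α₁(Lʲη)⁻²·e^{−δd}` (diagonal part by the lattice Leibniz rule, mixing part by
`comm_mixLetterB`; `V1Letter (inr k₀) = coefLetter (inr k₀) + mixLetterB k₀`).
[cite: Balaban1985BackgroundPropagators, (3.71) p.405 + (3.73) p.405 + (3.85) p.407; Balaban1985RegularSpaces, (1.87) p.91; Balaban1984PropagatorsII, (2.51)–(2.52) p.232] -/
theorem hasMajorant_comm_V1Letter_inr (blk : S → g.Site) (η : ℝ) (A : κ → S → 𝔸) (ρ d₀ δ M₂ α₁ : ℝ)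
    (hα₁ : 0 ≤ α₁) (hδ : 0 ≤ δ) (hM₂ : 0 ≤ M₂) (hrepr : ∀ (v : 𝔸) (i : ι), |b.repr v i| ≤ M₂ * ‖v‖)
    (h337F : ∀ μ x, ‖((η : ℂ)⁻¹) • covD T U μ (A μ) x‖ ≤ α₁ * (g.len (blk x) ^ 2)⁻¹)
    (h337Bτ : ∀ μ x, ‖((η : ℂ)⁻¹) • covDstar T U μ (tauB T U μ (A μ)) x‖ ≤ α₁ * (g.len (blk x) ^ 2)⁻¹)
    (h337B : ∀ k μ x, ‖((η : ℂ)⁻¹) • covDstar T U k (A μ) x‖ ≤ α₁ * (g.len (blk x) ^ 2)⁻¹)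
    (hρ : ∀ μ x, ‖((U μ x : 𝔸ˣ) : 𝔸)‖ ≤ ρ ∧ ‖(((U μ x)⁻¹ : 𝔸ˣ) : 𝔸)‖ ≤ ρ)
    (hd₀ : ∀ μ x, g.dist (blk x) (blk (T μ x)) ≤ d₀ ∧ g.dist (blk x) (blk ((T μ).symm x)) ≤ d₀) (k₀ : κ) :
    HasMajorant (g := toB6 g Rr H) (fun q : (κ × S) × ι => blk q.1.2)
      (conj b (V1Letter T U A (Sum.inr k₀)) * conj b (diffLetter (bT T) (bU U) ((η : ℂ)⁻¹) (Sum.inr k₀))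
        - conj b (diffLetter (bT T) (bU U) ((η : ℂ)⁻¹) (Sum.inr k₀)) * conj b (V1Letter T U A (Sum.inr k₀)))
      (fun y y' => (4 * ρ ^ 2 * M₂ * (∑ i, ‖b i‖) * Real.exp (δ * d₀)) * α₁ * (g.len y ^ 2)⁻¹ *
        Real.exp (-(δ * g.dist y y'))) := by
  have hcoef := hasMajorant_comm_coefLetter_bond (Rr := Rr) (H := H) b T U blk η A ρ d₀ δ M₂ α₁ hα₁ hδ hM₂ hrepr h337F h337Bτ hρ
    hd₀ (Sum.inr k₀)
  have hmix := hasMajorant_commMixB (Rr := Rr) (H := H) b T U blk ((η : ℂ)⁻¹) A ρ d₀ δ M₂ α₁ hα₁ hδ hM₂ hrepr h337B hρ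
    (fun μ x => (hd₀ μ x).2) k₀
  have hsplit : conj b (V1Letter T U A (Sum.inr k₀)) * conj b (diffLetter (bT T) (bU U) ((η : ℂ)⁻¹) (Sum.inr k₀))
        - conj b (diffLetter (bT T) (bU U) ((η : ℂ)⁻¹) (Sum.inr k₀)) * conj b (V1Letter T U A (Sum.inr k₀))
      = (conj b (coefLetter (bT T) (bU U) (Ab A) (Sum.inr k₀)) * conj b (diffLetter (bT T) (bU U) ((η : ℂ)⁻¹) (Sum.inr k₀))
          - conj b (diffLetter (bT T) (bU U) ((η : ℂ)⁻¹) (Sum.inr k₀)) * conj b (coefLetter (bT T) (bU U) (Ab A) (Sum.inr k₀)))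
        + -conj b (commMixB T U ((η : ℂ)⁻¹) A k₀) := by
    rw [← conj_neg, ← comm_mixLetterB T U ((η : ℂ)⁻¹) A k₀, conj_sub, B9Eq352DivFormLetters.conj_mul,
      B9Eq352DivFormLetters.conj_mul, V1Letter_inr, conj_add]
    noncomm_ring
  rw [hsplit]
  exact hasMajorant_mono (g := toB6 g Rr H) _
    (hasMajorant_add (g := toB6 g Rr H) _ hcoef (hasMajorant_neg' (Rr := Rr) (H := H) _ hmix)) fun y y' => le_of_eq (by ring)

/-- **`hComm` FOR `V1Letter₂ (inl k₀)` — COMPLETE**: `conj b (V1Letter₂ A (inl k₀)) * conj b (∇_{inl k₀}) − conj b (∇_{inl k₀}) * conj b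
(V1Letter₂ A (inl k₀)) ≺ 2ρ²d·M₂(Σ‖b_i‖)e^{δd₀}·α₁(Lʲη)⁻²·e^{−δd}` (`V1Letter₂ (inl k₀) = mixLetterF₂ k₀`, `comm_mixLetterF₂`).
[cite: Balaban1985BackgroundPropagators, (3.75) p.405 + (3.73) p.405 + (3.85) p.407; Balaban1985RegularSpaces, (1.87) p.91; Balaban1984PropagatorsII, (2.51)–(2.52) p.232] -/
theorem hasMajorant_comm_V1Letter₂_inl (blk : S → g.Site) (η : ℝ) (A : κ → S → 𝔸) (ρ d₀ δ M₂ α₁ : ℝ)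
    (hα₁ : 0 ≤ α₁) (hδ : 0 ≤ δ) (hM₂ : 0 ≤ M₂) (hrepr : ∀ (v : 𝔸) (i : ι), |b.repr v i| ≤ M₂ * ‖v‖)
    (h337F : ∀ k ν x, ‖((η : ℂ)⁻¹) • covD T U k (A ν) x‖ ≤ α₁ * (g.len (blk x) ^ 2)⁻¹)
    (hρ : ∀ μ x, ‖((U μ x : 𝔸ˣ) : 𝔸)‖ ≤ ρ ∧ ‖(((U μ x)⁻¹ : 𝔸ˣ) : 𝔸)‖ ≤ ρ)
    (hd₀F : ∀ μ x, g.dist (blk x) (blk (T μ x)) ≤ d₀) (k₀ : κ) :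
    HasMajorant (g := toB6 g Rr H) (fun q : (κ × S) × ι => blk q.1.2)
      (conj b (V1Letter₂ T U A (Sum.inl k₀)) * conj b (diffLetter (bT T) (bU U) ((η : ℂ)⁻¹) (Sum.inl k₀))
        - conj b (diffLetter (bT T) (bU U) ((η : ℂ)⁻¹) (Sum.inl k₀)) * conj b (V1Letter₂ T U A (Sum.inl k₀)))
      (fun y y' => (2 * ρ ^ 2 * Fintype.card κ * M₂ * (∑ i, ‖b i‖) * Real.exp (δ * d₀)) * α₁ * (g.len y ^ 2)⁻¹ *
        Real.exp (-(δ * g.dist y y'))) := by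
  have hmix := hasMajorant_commMixF₂ (Rr := Rr) (H := H) b T U blk ((η : ℂ)⁻¹) A ρ d₀ δ M₂ α₁ hα₁ hδ hM₂ hrepr h337F hρ hd₀F k₀
  have hsplit : conj b (V1Letter₂ T U A (Sum.inl k₀)) * conj b (diffLetter (bT T) (bU U) ((η : ℂ)⁻¹) (Sum.inl k₀))
        - conj b (diffLetter (bT T) (bU U) ((η : ℂ)⁻¹) (Sum.inl k₀)) * conj b (V1Letter₂ T U A (Sum.inl k₀))
      = -conj b (commMixF₂ T U ((η : ℂ)⁻¹) A k₀) := by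
    rw [← conj_neg, ← comm_mixLetterF₂ T U ((η : ℂ)⁻¹) A k₀, conj_sub, B9Eq352DivFormLetters.conj_mul,
      B9Eq352DivFormLetters.conj_mul, V1Letter₂_inl]
  rw [hsplit]
  exact hasMajorant_neg' (Rr := Rr) (H := H) _ hmix

end Majorants

end Literature.MathematicalPhysics.QuantumFieldTheory.Balaban1983to89.B9Eq373CommLetters
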